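import Summits.ResolutionOfSingularities.ResolutionOfSingularities.Theses.PAlteration
import Literature.AlgebraicGeometry.Resolution.AlterationsResolution
import Literature.AlgebraicGeometry.Resolution.AlterationsProofs
import Literature.AlgebraicGeometry.Resolution.AbsoluteIntegralClosureNoResolution
import Literature.AlgebraicGeometry.Resolution.RegularLocalRingsNormal

/-!
# Disproof of `Pialt` (crux `stmt-ResolutionOfSingularities-0555`, route `pAlteration`) — findings

Standing adversary work file (cdisprove gen 1, v1.1, 2026-08-16,
refuter-cdisprove-stmt-ResolutionOfSingularities-0555-0). Prose only in docstrings; every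
`theorem` below is sorry-free. NO declaration concludes the route decl `Pialt` positively
(the sandwich results are stated as `¬ Pialt → ¬ …`).

LANDED (importable; ideators / planners / provers may `import` these):
* `Summits.ResolutionOfSingularities.ResolutionOfSingularities.Theorems.Pialt.Negative.LoadBearing`
  (p89952 ACCEPTED 2026-08-16, commit 4700cab16224; rev 2 p90663 adds
  `pialt_false_without_irreducible`): §A in negative form, §C `IsIntegral`, §C' all four, §D
  birational ⇔ summit — namespace `…Theorems.Pialt.Negative`, names `exists_not_hasResolution_of_not_pialt`,
  `not_resolutionOfSingularities_of_not_pialt`, `not_abramovichOortConjecture_of_not_pialt`,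
  `not_pialt_of_not_abramovichOortConjecture`, `pialt_false_without_isIntegral`,
  `pialt_false_without_irreducible`, `pialt_without_universallyInjective_of_deJong1996`,
  `pialt_without_dense_of_deJong1996`, `pialt_without_isRegular_trivial`,
  `pialt_without_surjective_trivial`, `pialt_birational_iff_resolutionOfSingularities`.
* `…Theorems.Pialt.Negative.FiniteTypeLoadBearing` (p89960 ACCEPTED, commit 06ab969aa313):
  `not_surjective_of_isIntegral_of_isNoetherianRing_stalk`, `pialt_false_without_locallyOfFiniteType(_at)`.
* `…Theorems.Pialt.Negative.FiniteStrengtheningFalse` (p89964 ACCEPTED, commit 4700cab16224):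
  `isNilpotent_of_appTop_eq_zero`, `isUnit_of_isUnit_appTop`, `node_eval_zero_eq_eval_one`,
  `not_pialtFinite_at`, `not_pialtFinite`.

THE CRUX. `Pialt` = for every prime `p`, every integral separated finite-type `X / k`,
`char k = p`, has a proper surjective `g : X' → X` with `X'` integral regular and `g` finite +
universally injective over a dense open of `X` — a purely inseparable regular alteration
(Abramovich–Oort 2000 Q. 2.13 / Temkin 2013 Conj. 1.3.1, positive-characteristic slice; in tree
as the `@[conjecture] def Literature.AlgebraicGeometry.Resolution.AbramovichOortConjecture`).

FINDINGS.
* §A SANDWICH (proved). The summit implies the crux pointwise (`pialtAt_of_hasResolution`: a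
  weak resolution IS a p.i. regular alteration, `U` = its iso-locus), hence
  `¬ Pialt → ¬ ResolutionOfSingularities` (`not_resolutionOfSingularities_of_not_pialt`) and,
  sharper, ANY WITNESS AGAINST THE CRUX IS THE SAME INTEGRAL VARIETY WITHOUT A WEAK RESOLUTION
  (`exists_not_hasResolution_of_not_pialt`). `¬ Pialt → ¬ AbramovichOortConjecture.{0}` and,
  modulo `Hironaka1964`, conversely (`not_pialt_of_not_abramovichOortConjecture`): the crux IS the
  named open conjecture's char-`p` slice. So a kill of this crux = a counterexample to resolution
  of singularities in characteristic `p` — none is in print.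
* §B KNOWN SLICES (proved, modulo the named facts): regular `X`; dimension `0` (unconditional);
  dimension `≤ 3` over any field (`CossartPiltant2019`); characteristic `0` (`Hironaka1964`).
  A counterexample must be an integral variety of dimension `≥ 4` over a field of char `p > 0`
  (barrier `Literature.Barriers.ResolutionOfSingularities.DimensionFourFrontier` applies verbatim).
* §C LOAD-BEARING HYPOTHESES (proved).
  - `IsIntegral X` dropped (even keeping `IsReduced X`) ⇒ FALSE: `X = ∅` over `𝔽₂`
    (`pialt_false_without_isIntegral`); keeping `IsReduced X ∧ Nonempty X` ⇒ still FALSE: the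
    two-point scheme `Spec (𝔽₂ × 𝔽₂)` (`pialt_false_without_irreducible`: the image of the
    irreducible `X'` would be irreducible) — IRREDUCIBILITY itself is load-bearing.
  - `LocallyOfFiniteType f` dropped ⇒ FALSE at every prime: `Spec 𝔽_p[X]⁺ → Spec 𝔽_p` (absolute
    integral closure of the affine line; affine, integral) admits NO SURJECTION AT ALL from an
    integral scheme with Noetherian stalks (`not_surjective_of_forall_exists_sq_eq`: iterated
    square roots + Krull intersection in the stalk + injectivity of germs on an integral scheme),
    so properness / finiteness / radiciality are not even needed to kill it
    (`pialt_false_without_locallyOfFiniteType(_at)`).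
  - `p.Prime` / `CharP k p`: NOT load-bearing (the char-`0` case is Hironaka, §B).
  - `IsSeparated f`, `QuasiCompact f`: no attack found (resolution-type statements are expected
    to survive both; not pursued).
* §C' LOAD-BEARING CONCLUSIONS (proved).
  - `UniversallyInjective (g ∣_ U)` dropped ⇒ de Jong's 1996 alteration theorem (named fact
    `DeJong1996`; `pialtWithoutUniversallyInjective_of_deJong1996`): RADICIALITY IS THE ENTIRE
    OPEN CONTENT of the crux (Gabber: prime-to-ℓ degree; Temkin 2017: `p`-power degree — neither
    purely inseparable).
  - `Scheme.IsRegular X'` dropped ⇒ trivial (identity; `pialtWithoutIsRegular_trivial`).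
  - `Dense U` dropped ⇒ `U = ∅` is junk-admissible and the rest follows from `DeJong1996`
    (`pialtWithoutDense_of_deJong1996`); for integral `X`, dense = non-empty (Temkin's wording).
  - `Function.Surjective g.base` dropped ⇒ TRIVIAL (`pialtWithoutSurjective_trivial`: a closed
    point `Spec κ(x) ↪ X` with `U = X ∖ {x}` — empty source over `U` — or the identity if `X` is
    a single point).
* §D NATURAL STRENGTHENINGS.
  - "isomorphism over `U`" instead of "finite + UI over `U`" is EXACTLY the summit
    (`pialtBirational_iff_resolutionOfSingularities`, proved with the in-tree reduced → integral
    descent): the whole distance crux → summit is "radicial ↦ iso over the dense open", i.e. the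
    route's second crux `Picover`.
  - "finite + UI over ALL of `X`" (no blow-up) is FALSE at every prime (§D', proved:
    `not_pialtFinite(_at)`): for the node `A = k[T² − T, T³ − T²] ⊂ k[T]` a finite radicial
    surjective `X' → Spec A` with `X'` integral regular (hence `X' = Spec B` affine, `B` a normal
    domain finite over `A`) forces `T ∈ B`, `k[T] ↪ B` integral, and two primes of `B` (over
    `T = 0` and `T = 1`) above the node — contradicting injectivity. So at non-unibranch points
    the alteration of the crux must genuinely blow up; the `∃ U dense` relaxation is necessary.

WHY IT RESISTS. `DeJong1996 ≤ Pialt ≤ ResolutionOfSingularities = PialtBirational`, and `Pialt`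
is known exactly where resolution is known; every cheap attack (degenerate `X`, junk `U`, junk
`X'`, dropping a hypothesis) is absorbed by `IsIntegral X`, `Dense U`, `Function.Surjective g.base`
and finite type, as certified above. A genuine kill needs a dimension `≥ 4` variety in char `p`
all of whose regular alterations have a separable (e.g. Artin–Schreier) factor in the function
field extension — which would in particular be a variety without resolution.

## Sources
* M. Temkin, J. Algebra 373 (2013) 65–119 (arXiv:0804.1554v3): Conj. 1.3.1, Thm. 1.3.2, §1 (i),(iii).
* D. Abramovich, F. Oort, Progr. Math. 181 (2000), Q. 2.13 / Cor. 2.9 (arXiv:math/9806100).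
* A. J. de Jong, Publ. IHÉS 83 (1996), Thm. 4.1 (named fact `DeJong1996`).
* V. Cossart, O. Piltant, J. Algebra 529 (2019), Thm. 1.1 (named fact `CossartPiltant2019`).
* M. Artin, Adv. Math. 7 (1971) (absolute integral closure); the Noetherian-root-closed argument
  is folklore (tree: `AbsoluteIntegralClosureNoResolution.lean`).
-/

noncomputable section

-- single-problem summit: the doubled namespace component `ResolutionOfSingularities` is forced
set_option linter.dupNamespace false

open CategoryTheory AlgebraicGeometry TopologicalSpace Topology Polynomial
open Literature.AlgebraicGeometry.Resolution

namespace Summit.ResolutionOfSingularities.ResolutionOfSingularities.Cruxes.Pialt.Disproof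

open Summit.ResolutionOfSingularities.ResolutionOfSingularities.Theses.PAlteration (Pialt)

/-! ## §0 The conclusion of the crux at one scheme -/

/-- The conclusion of `Pialt` for a single scheme `X`: a proper surjective `g : X' → X` from an
integral regular scheme, finite and universally injective over a dense open of `X`. -/
def PialtAt (X : Scheme.{0}) : Prop :=
  ∃ (X' : Scheme.{0}) (g : X' ⟶ X), IsProper g ∧ IsIntegral X' ∧ Scheme.IsRegular X' ∧
    Function.Surjective g.base ∧ ∃ U : X.Opens, Dense (U : Set X) ∧ IsFinite (g ∣_ U) ∧
      UniversallyInjective (g ∣_ U)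

/-- `Pialt` unfolds to `PialtAt` over all integral separated finite-type schemes over fields of
prime characteristic. -/
theorem pialt_iff :
    Pialt ↔ ∀ p : ℕ, p.Prime → ∀ (k : Type) [Field k] [CharP k p] (X : Scheme.{0})
      (f : X ⟶ Spec (.of k)), IsSeparated f → LocallyOfFiniteType f → QuasiCompact f →
        IsIntegral X → PialtAt X :=
  Iff.rfl

/-- A purely inseparable alteration with regular source gives the crux conclusion (over an
integral target the non-empty open of finiteness/radiciality is dense). -/
theorem pialtAt_of_isPurelyInseparableAlteration {X' X : Scheme.{0}} [IsIntegral X] {φ : X' ⟶ X}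
    (h : IsPurelyInseparableAlteration φ) (hreg : Scheme.IsRegular X') : PialtAt X :=
  ⟨X', φ, h.isProper, h.isIntegral, hreg, h.surjective.1, h.exists_dense⟩

/-- Conversely the crux conclusion is a purely inseparable alteration with regular source. -/
theorem exists_isPurelyInseparableAlteration_of_pialtAt {X : Scheme.{0}} [IsIntegral X]
    (h : PialtAt X) :
    ∃ (Y : Scheme.{0}) (φ : Y ⟶ X), IsPurelyInseparableAlteration φ ∧ Scheme.IsRegular Y := by
  obtain ⟨X', g, hprop, hint, hreg, hsurj, U, hU, hfin, hui⟩ := h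
  haveI : Surjective g := ⟨hsurj⟩
  exact ⟨X', g, ⟨hint, hprop, inferInstance, U, hU.nonempty, hfin, hui⟩, hreg⟩

/-! ## §A Sandwich: the summit implies the crux -/

/-- A (weak) resolution of an integral scheme IS a purely inseparable regular alteration. -/
theorem pialtAt_of_hasResolution (X : Scheme.{0}) [IsIntegral X] (h : Scheme.HasResolution X) :
    PialtAt X := by
  obtain ⟨Y, φ, hφ, hreg⟩ := h.exists_isPurelyInseparableAlteration_and_isRegular
  exact pialtAt_of_isPurelyInseparableAlteration hφ hreg

/-- **Any counterexample to the crux is itself an integral separated finite-type variety over a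
field of characteristic `p` WITHOUT a weak resolution** (the summit implies the crux, pointwise:
`pialtAt_of_hasResolution`). Stated negatively on purpose: no declaration of this file concludes
the route decl `Pialt` positively. -/
theorem exists_not_hasResolution_of_not_pialt (h : ¬ Pialt) :
    ∃ p : ℕ, p.Prime ∧ ∃ (k : Type) (_ : Field k) (_ : CharP k p) (X : Scheme.{0})
      (f : X ⟶ Spec (.of k)), IsSeparated f ∧ LocallyOfFiniteType f ∧ QuasiCompact f ∧
        IsIntegral X ∧ ¬ Scheme.HasResolution X := by
  by_contra hcon
  apply h
  intro p hp k _ _ X f hs hl hq hi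
  by_contra hX
  exact hcon ⟨p, hp, k, inferInstance, inferInstance, X, f, hs, hl, hq, hi,
    fun hres => hX (pialtAt_of_hasResolution X hres)⟩

/-- **A disproof of the crux is a disproof of resolution of singularities in positive
characteristic** (`¬ Pialt → ¬ ResolutionOfSingularities`). -/
theorem not_resolutionOfSingularities_of_not_pialt (h : ¬ Pialt) :
    ¬ _root_.ResolutionOfSingularities := by
  obtain ⟨p, hp, k, _, _, X, f, hs, hl, hq, hi, hX⟩ := exists_not_hasResolution_of_not_pialt h
  exact fun hres => hX (hres p hp k X f hs hl hq inferInstance)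

/-- A disproof of the crux disproves the named open conjecture `AbramovichOortConjecture`
(all characteristics; Temkin 2013 Conj. 1.3.1). -/
theorem not_abramovichOortConjecture_of_not_pialt (h : ¬ Pialt) :
    ¬ AbramovichOortConjecture.{0} := by
  intro hAO
  apply h
  intro p hp k _ _ X f hs hl hq hi
  obtain ⟨Y, φ, hφ, hreg⟩ := hAO k X f hs hl hq hi
  exact pialtAt_of_isPurelyInseparableAlteration hφ hreg

/-- Conversely, modulo Hironaka (characteristic `0`), a disproof of `AbramovichOortConjecture`
is a disproof of the crux: the crux IS the conjecture's positive-characteristic slice. -/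
theorem not_pialt_of_not_abramovichOortConjecture (h0 : Hironaka1964.{0})
    (h : ¬ AbramovichOortConjecture.{0}) : ¬ Pialt := by
  intro hP
  apply h
  intro k _ X f hs hl hq hi
  obtain ⟨p, hchar⟩ := CharP.exists k
  rcases CharP.char_is_prime_or_zero k p with hp | rfl
  · exact exists_isPurelyInseparableAlteration_of_pialtAt (hP p hp k X f hs hl hq hi)
  · haveI : CharZero k := CharP.charP_to_charZero k
    haveI := hs; haveI := hl; haveI := hq
    exact abramovichOort_of_hironaka1964 h0 k X f

/-! ## §B Known slices: where a counterexample cannot live -/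

/-- Regular `X`: the identity. -/
theorem pialtAt_of_isRegular (X : Scheme.{0}) [IsIntegral X] (h : Scheme.IsRegular X) :
    PialtAt X :=
  pialtAt_of_hasResolution X h.hasResolution

/-- Dimension `0`, unconditionally. -/
theorem pialtAt_of_topologicalKrullDim_le_zero (X : Scheme.{0}) [IsIntegral X]
    (hdim : topologicalKrullDim X ≤ 0) : PialtAt X :=
  pialtAt_of_isRegular X (Scheme.IsRegular.of_topologicalKrullDim_le_zero hdim)

/-- Dimension `≤ 3` (any characteristic), modulo the named fact `CossartPiltant2019`: a
counterexample to the crux has dimension `≥ 4` (barrier `DimensionFourFrontier`). -/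
theorem pialtAt_of_dim_le_three (h : CossartPiltant2019.{0}) (k : Type) [Field k]
    (X : Scheme.{0}) (f : X ⟶ Spec (.of k)) [IsSeparated f] [LocallyOfFiniteType f]
    [QuasiCompact f] [IsIntegral X] (hdim : topologicalKrullDim X ≤ 3) : PialtAt X := by
  obtain ⟨Y, φ, hφ, hreg⟩ := abramovichOort_of_cossartPiltant2019 h k X f hdim
  exact pialtAt_of_isPurelyInseparableAlteration hφ hreg

/-- Characteristic `0`, modulo `Hironaka1964`: the hypotheses `p.Prime` / `CharP k p` of the crux
are not load-bearing (the same conclusion holds in characteristic `0`). -/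
theorem pialtAt_of_charZero (h : Hironaka1964.{0}) (k : Type) [Field k] [CharZero k]
    (X : Scheme.{0}) (f : X ⟶ Spec (.of k)) [IsSeparated f] [LocallyOfFiniteType f]
    [QuasiCompact f] [IsIntegral X] : PialtAt X := by
  obtain ⟨Y, φ, hφ, hreg⟩ := abramovichOort_of_hironaka1964 h k X f
  exact pialtAt_of_isPurelyInseparableAlteration hφ hreg

/-! ## §C Load-bearing hypotheses -/

/-- The crux with `IsIntegral X` weakened to the summit's `IsReduced X`. -/
def PialtWithoutIsIntegral : Prop :=
  ∀ p : ℕ, p.Prime → ∀ (k : Type) [Field k] [CharP k p] (X : Scheme.{0})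
    (f : X ⟶ Spec (.of k)), IsSeparated f → LocallyOfFiniteType f → QuasiCompact f →
      IsReduced X → PialtAt X

/-- **`IsIntegral X` is load-bearing**: with only `IsReduced X` the statement fails at the empty
scheme over `𝔽₂` (an integral `X'` is non-empty and cannot map to `∅`).  (The two-point scheme
`Spec (k × k)` fails too — the image of an irreducible `X'` is irreducible — so irreducibility,
not just non-emptiness, is needed; only the empty witness is formalised.) -/
theorem pialt_false_without_isIntegral : ¬ PialtWithoutIsIntegral := by
  intro h
  haveI : IsReduced (∅ : Scheme.{0}) := ⟨fun U => ⟨fun x _ => Subsingleton.elim x 0⟩⟩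
  obtain ⟨X', g, -, hint, -⟩ := h 2 Nat.prime_two (ZMod 2) (∅ : Scheme.{0})
    (Scheme.emptyTo _) inferInstance inferInstance inferInstance inferInstance
  obtain ⟨x⟩ := hint.nonempty
  exact IsEmpty.false (g.base x)

/-- **Irreducibility of `X` is load-bearing, not just non-emptiness**: with `IsIntegral X`
weakened to `IsReduced X ∧ Nonempty X` the crux fails at the two-point scheme
`Spec (𝔽₂ × 𝔽₂) → Spec 𝔽₂` (affine, reduced, of finite type): the image of the irreducible `X'`
under the surjective `g` would make `Spec (𝔽₂ × 𝔽₂)` irreducible, but `D(1,0)` and `D(0,1)`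
are disjoint non-empty opens. [folklore] -/
theorem pialt_false_without_irreducible :
    ¬ ∀ p : ℕ, p.Prime → ∀ (k : Type) [Field k] [CharP k p] (X : Scheme.{0})
      (f : X ⟶ Spec (.of k)), IsSeparated f → LocallyOfFiniteType f → QuasiCompact f →
        IsReduced X → Nonempty X → ∃ (X' : Scheme.{0}) (g : X' ⟶ X), IsProper g ∧
          IsIntegral X' ∧ Scheme.IsRegular X' ∧ Function.Surjective g.base ∧
            ∃ U : X.Opens, Dense (U : Set X) ∧ IsFinite (g ∣_ U) ∧
              UniversallyInjective (g ∣_ U) := by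
  intro h
  let R := ZMod 2 × ZMod 2
  let f : Spec (.of R) ⟶ Spec (.of (ZMod 2)) :=
    Spec.map (CommRingCat.ofHom (algebraMap (ZMod 2) R))
  haveI : LocallyOfFiniteType f :=
    (HasRingHomProperty.Spec_iff (P := @LocallyOfFiniteType)).mpr
      (RingHom.finiteType_algebraMap.mpr inferInstance)
  haveI : Nonempty ↥(Spec (.of R)) := ⟨(⟨Ideal.prod ⊥ ⊤, Ideal.isPrime_ideal_prod_top⟩ :
    PrimeSpectrum R)⟩
  obtain ⟨X', g, -, hint, -, hsurj, -⟩ :=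
    h 2 Nat.prime_two (ZMod 2) (Spec (.of R)) f inferInstance inferInstance inferInstance
      inferInstance inferInstance
  -- the image of the irreducible `X'` is everything, so `Spec R` would be (pre)irreducible
  have hirr : IsPreirreducible (Set.univ : Set (PrimeSpectrum R)) := by
    have h1 := (IrreducibleSpace.isIrreducible_univ ↥X').isPreirreducible.image g.base
      g.base.hom.continuous.continuousOn
    rw [Set.image_univ, Set.range_eq_univ.mpr hsurj] at h1
    exact h1
  -- but `D(1,0) ∋ (0 × 𝔽₂)` and `D(0,1) ∋ (𝔽₂ × 0)` are disjoint non-empty opens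
  let e₁ : R := (1, 0)
  let e₂ : R := (0, 1)
  let x₁ : PrimeSpectrum R := ⟨Ideal.prod ⊥ ⊤, Ideal.isPrime_ideal_prod_top⟩
  let x₂ : PrimeSpectrum R := ⟨Ideal.prod ⊤ ⊥, Ideal.isPrime_ideal_prod_top'⟩
  have hx₁ : x₁ ∈ (PrimeSpectrum.basicOpen e₁ : Set (PrimeSpectrum R)) :=
    (PrimeSpectrum.mem_basicOpen _ _).mpr fun hmem =>
      one_ne_zero (Ideal.mem_bot.mp ((Ideal.mem_prod _ _).mp hmem).1)
  have hx₂ : x₂ ∈ (PrimeSpectrum.basicOpen e₂ : Set (PrimeSpectrum R)) :=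
    (PrimeSpectrum.mem_basicOpen _ _).mpr fun hmem =>
      one_ne_zero (Ideal.mem_bot.mp ((Ideal.mem_prod _ _).mp hmem).2)
  obtain ⟨x, -, hx1, hx2⟩ := hirr _ _ (PrimeSpectrum.basicOpen e₁).isOpen
    (PrimeSpectrum.basicOpen e₂).isOpen ⟨x₁, Set.mem_univ _, hx₁⟩ ⟨x₂, Set.mem_univ _, hx₂⟩
  have h12 : e₁ * e₂ ∈ x.asIdeal := by
    have : e₁ * e₂ = 0 := by simp [e₁, e₂, R]
    rw [this]; exact Ideal.zero_mem _
  rcases x.2.mem_or_mem h12 with h1 | h2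
  · exact (PrimeSpectrum.mem_basicOpen _ _).mp hx1 h1
  · exact (PrimeSpectrum.mem_basicOpen _ _).mp hx2 h2

/-- **No integral scheme with Noetherian stalks surjects onto the spectrum of a root-closed
domain with a non-zero prime.** If every element of the domain `R` is a square and `Q ≠ 0` is a
prime, `X'` is integral with Noetherian local rings and `g : X' → Spec R` hits `Q`, say at `x`,
then for `0 ≠ q ∈ Q` with iterated square roots `bₙ` (`bₙ ^ 2ⁿ = q`, all in `Q`) the germs at `x`
of the pulled-back sections `g*(bₙ)` are non-units, so the germ of `g*(q)` lies in `⋂ₙ 𝔪ₓⁿ = 0`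
(Krull); as `X'` is integral, `g*(q) = 0`, so `g⁻¹ D(q) = ∅`, and surjectivity forces `D(q) = ∅`,
i.e. `q` nilpotent, `q = 0`. [folklore] -/
theorem not_surjective_of_forall_exists_sq_eq {R : Type} [CommRing R] [IsDomain R]
    (hsq : ∀ a : R, ∃ b : R, b ^ 2 = a) {Q : Ideal R} (hQp : Q.IsPrime) (hQ : Q ≠ ⊥)
    {X' : Scheme.{0}} [IsIntegral X'] (hN : ∀ x : X', IsNoetherianRing (X'.presheaf.stalk x))
    (g : X' ⟶ Spec (.of R)) : ¬ Function.Surjective g.base := by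
  intro hsurj
  -- a non-zero element of `Q` and its iterated square roots
  obtain ⟨q, hqQ, hq0⟩ := Submodule.exists_mem_ne_zero_of_ne_bot hQ
  choose sq hsq using hsq
  let b : ℕ → R := fun n => Nat.rec q (fun _ c => sq c) n
  have hb0 : b 0 = q := rfl
  have hbsucc : ∀ n, b (n + 1) = sq (b n) := fun n => rfl
  have hbpow : ∀ n, (b n) ^ (2 ^ n) = q := by
    intro n
    induction n with
    | zero => simp [hb0]
    | succ n ih => rw [pow_succ, pow_mul', hbsucc, hsq, ih]
  have hbQ : ∀ n, b n ∈ Q := fun n => hQp.mem_of_pow_mem (2 ^ n) (by rw [hbpow]; exact hqQ)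
  -- the point of `X'` over `Q`
  let y : ↥(Spec (.of R)) := (⟨Q, hQp⟩ : PrimeSpectrum R)
  obtain ⟨x, hx⟩ := hsurj y
  -- the pulled-back sections
  let r : ℕ → Γ(Spec (.of R), ⊤) := fun n => (Scheme.ΓSpecIso (.of R)).inv (b n)
  let t : ℕ → Γ(X', ⊤) := fun n => g.appTop (r n)
  have htpow : ∀ n, (t n) ^ (2 ^ n) = t 0 := by
    intro n
    simp only [t, r, ← map_pow, hbpow, hb0]
  -- `x ∉ X'.basicOpen (t n)` because `bₙ ∈ Q = g x`
  have hxnot : ∀ n, x ∉ X'.basicOpen (t n) := by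
    intro n hxmem
    rw [← Scheme.preimage_basicOpen_top] at hxmem
    have h2 : g.base x ∈ (Spec (.of R)).basicOpen (r n) := hxmem
    rw [hx, basicOpen_eq_of_affine] at h2
    exact (PrimeSpectrum.mem_basicOpen _ _).mp h2 (hbQ n)
  -- hence the germs are non-units and the germ of `t 0` is in every power of the maximal ideal
  have hgerm_mem : ∀ n, X'.presheaf.germ ⊤ x trivial (t n) ∈
      IsLocalRing.maximalIdeal (X'.presheaf.stalk x) := by
    intro n
    rw [IsLocalRing.mem_maximalIdeal, mem_nonunits_iff]
    exact fun hu => hxnot n ((Scheme.mem_basicOpen_top _ _ _).mpr hu)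
  have hgerm0 : X'.presheaf.germ ⊤ x trivial (t 0) ∈
      ⨅ n : ℕ, IsLocalRing.maximalIdeal (X'.presheaf.stalk x) ^ n := by
    refine Submodule.mem_iInf _ |>.mpr fun n => ?_
    have h1 : X'.presheaf.germ ⊤ x trivial (t 0) = (X'.presheaf.germ ⊤ x trivial (t n)) ^ (2 ^ n) := by
      rw [← map_pow, htpow]
    rw [h1]
    exact Ideal.pow_le_pow_right Nat.lt_two_pow_self.le (Ideal.pow_mem_pow (hgerm_mem n) _)
  haveI := hN x
  rw [Ideal.iInf_pow_eq_bot_of_isLocalRing _ (IsLocalRing.maximalIdeal.isMaximal _).ne_top,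
    Ideal.mem_bot] at hgerm0
  -- so `t 0 = g*(q) = 0` (germs of an integral scheme are injective)
  have ht0 : t 0 = 0 :=
    germ_injective_of_isIntegral X' (U := ⊤) x trivial (by rw [hgerm0, map_zero])
  -- `D(q)` is empty: its preimage is `X'.basicOpen 0 = ∅` and `g` is surjective
  have hpre : g ⁻¹ᵁ (Spec (.of R)).basicOpen (r 0) = ⊥ := by
    rw [Scheme.preimage_basicOpen_top]
    show X'.basicOpen (t 0) = ⊥
    rw [ht0, Scheme.basicOpen_zero]
  have hD' : (Spec (.of R)).basicOpen (r 0) = ⊥ := by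
    ext z
    simp only [TopologicalSpace.Opens.coe_bot, Set.mem_empty_iff_false, iff_false]
    intro hz
    obtain ⟨w, hw⟩ := hsurj z
    have hw' : w ∈ g ⁻¹ᵁ (Spec (.of R)).basicOpen (r 0) := by
      show g.base w ∈ ((Spec (.of R)).basicOpen (r 0) : Set _)
      rw [hw]; exact hz
    rw [hpre] at hw'
    exact hw'
  have hD : PrimeSpectrum.basicOpen (R := R) q = ⊥ := by
    have h1 := hD'
    simp only [r] at h1
    rw [basicOpen_eq_of_affine] at h1
    exact h1
  rw [PrimeSpectrum.basicOpen_eq_bot_iff] at hD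
  exact hq0 hD.eq_zero

/-- The crux with `LocallyOfFiniteType f` dropped. -/
def PialtWithoutLocallyOfFiniteType : Prop :=
  ∀ p : ℕ, p.Prime → ∀ (k : Type) [Field k] [CharP k p] (X : Scheme.{0})
    (f : X ⟶ Spec (.of k)), IsSeparated f → QuasiCompact f → IsIntegral X → PialtAt X

open Polynomial in
/-- **`LocallyOfFiniteType` is load-bearing**, at every prime `p`: the absolute integral closure
`Spec 𝔽_p[X]⁺ → Spec 𝔽_p` (affine: separated and quasi-compact; integral) admits NO surjection
from an integral scheme with Noetherian stalks (`not_surjective_of_forall_exists_sq_eq` with the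
tree's `absoluteIntegralClosure_exists_sq_eq` / `absoluteIntegralClosure_exists_prime_not_mem`),
let alone a purely inseparable regular alteration. [folklore] -/
theorem pialt_false_without_locallyOfFiniteType_at (p : ℕ) [hp : Fact p.Prime] :
    ¬ ∀ (k : Type) [Field k] [CharP k p] (X : Scheme.{0}) (f : X ⟶ Spec (.of k)),
      IsSeparated f → QuasiCompact f → IsIntegral X → PialtAt X := by
  intro h
  let f : Spec (.of ↥(integralClosure (ZMod p)[X] (AlgebraicClosure (RatFunc (ZMod p))))) ⟶
      Spec (.of (ZMod p)) :=
    Spec.map (CommRingCat.ofHom ((algebraMap (ZMod p)[X]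
      ↥(integralClosure (ZMod p)[X] (AlgebraicClosure (RatFunc (ZMod p))))).comp Polynomial.C))
  obtain ⟨X', g, -, hint, hreg, hsurj, -⟩ := h (ZMod p) _ f inferInstance inferInstance inferInstance
  -- a non-zero prime of `𝔽_p[X]⁺`: one avoiding the (non-zero) image of `X`
  have hX0 : algebraMap (ZMod p)[X]
      ↥(integralClosure (ZMod p)[X] (AlgebraicClosure (RatFunc (ZMod p)))) Polynomial.X ≠ 0 :=
    fun h0 => Polynomial.X_ne_zero
      ((absoluteIntegralClosure_algebraMap_injective p) (h0.trans (map_zero _).symm))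
  obtain ⟨Q, hQp, hQ, -⟩ := absoluteIntegralClosure_exists_prime_not_mem p _ hX0
  exact not_surjective_of_forall_exists_sq_eq (absoluteIntegralClosure_exists_sq_eq p) hQp hQ
    (fun x => by haveI := hreg x; infer_instance) g hsurj

theorem pialt_false_without_locallyOfFiniteType : ¬ PialtWithoutLocallyOfFiniteType :=
  fun h => pialt_false_without_locallyOfFiniteType_at 2 (fun k _ _ X f hs hq hi => h 2 Nat.prime_two k X f hs hq hi)

/-! ## §C' Load-bearing parts of the conclusion -/

/-- The crux with `UniversallyInjective (g ∣_ U)` dropped from the conclusion. -/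
def PialtWithoutUniversallyInjective : Prop :=
  ∀ p : ℕ, p.Prime → ∀ (k : Type) [Field k] [CharP k p] (X : Scheme.{0})
    (f : X ⟶ Spec (.of k)), IsSeparated f → LocallyOfFiniteType f → QuasiCompact f →
      IsIntegral X → ∃ (X' : Scheme.{0}) (g : X' ⟶ X), IsProper g ∧ IsIntegral X' ∧
        Scheme.IsRegular X' ∧ Function.Surjective g.base ∧
          ∃ U : X.Opens, Dense (U : Set X) ∧ IsFinite (g ∣_ U)

/-- **Radiciality is the whole open content**: without `UniversallyInjective` the crux is de
Jong's alteration theorem (named fact `DeJong1996`, Thm. 4.1, weak form). -/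
theorem pialtWithoutUniversallyInjective_of_deJong1996 (h : DeJong1996.{0}) :
    PialtWithoutUniversallyInjective := by
  intro p hp k _ _ X f hs hl hq hi
  obtain ⟨X₁, φ, hφ, hreg⟩ := h k X f hs hl hq hi
  obtain ⟨U, hU, hfin⟩ := hφ.exists_isFinite
  exact ⟨X₁, φ, hφ.isProper, hφ.isIntegral, hreg, hφ.surjective.1, U, U.isOpen.dense hU, hfin⟩

/-- Trivially, `Pialt` implies its UI-free weakening. -/
theorem pialtWithoutUniversallyInjective_of_pialt (h : Pialt) :
    PialtWithoutUniversallyInjective := by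
  intro p hp k _ _ X f hs hl hq hi
  obtain ⟨X', g, hprop, hint, hreg, hsurj, U, hU, hfin, -⟩ := h p hp k X f hs hl hq hi
  exact ⟨X', g, hprop, hint, hreg, hsurj, U, hU, hfin⟩

/-- **`Scheme.IsRegular X'` carries all the content**: with it dropped the statement is
trivial (the identity of `X`). -/
theorem pialtWithoutIsRegular_trivial :
    ∀ p : ℕ, p.Prime → ∀ (k : Type) [Field k] [CharP k p] (X : Scheme.{0})
      (f : X ⟶ Spec (.of k)), IsSeparated f → LocallyOfFiniteType f → QuasiCompact f →
        IsIntegral X → ∃ (X' : Scheme.{0}) (g : X' ⟶ X), IsProper g ∧ IsIntegral X' ∧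
          Function.Surjective g.base ∧ ∃ U : X.Opens, Dense (U : Set X) ∧ IsFinite (g ∣_ U) ∧
            UniversallyInjective (g ∣_ U) := by
  intro p hp k _ _ X f hs hl hq hi
  exact ⟨X, 𝟙 X, inferInstance, hi, (inferInstance : Surjective (𝟙 X)).1, ⊤, by simp,
    inferInstance, inferInstance⟩

/-- **`Dense U` only excludes the junk `U = ∅`**: with it dropped, `U = ⊥` makes the finiteness
and radiciality conjuncts vacuous (empty source), and what remains — a proper surjection from an
integral regular scheme — is a consequence of de Jong's theorem (`DeJong1996`). For integral `X`
"dense" = "non-empty", matching Temkin's wording. -/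
theorem pialtWithoutDense_of_deJong1996 (h : DeJong1996.{0}) :
    ∀ p : ℕ, p.Prime → ∀ (k : Type) [Field k] [CharP k p] (X : Scheme.{0})
      (f : X ⟶ Spec (.of k)), IsSeparated f → LocallyOfFiniteType f → QuasiCompact f →
        IsIntegral X → ∃ (X' : Scheme.{0}) (g : X' ⟶ X), IsProper g ∧ IsIntegral X' ∧
          Scheme.IsRegular X' ∧ Function.Surjective g.base ∧
            ∃ U : X.Opens, IsFinite (g ∣_ U) ∧ UniversallyInjective (g ∣_ U) := by
  intro p hp k _ _ X f hs hl hq hi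
  obtain ⟨X₁, φ, hφ, hreg⟩ := h k X f hs hl hq hi
  haveI : IsEmpty (↑(φ ⁻¹ᵁ (⊥ : X.Opens)) : Scheme.{0}) :=
    ⟨fun x => TopologicalSpace.Opens.mem_bot.mp (show φ.base x.1 ∈ (⊥ : X.Opens) from x.2)⟩
  exact ⟨X₁, φ, hφ.isProper, hφ.isIntegral, hreg, hφ.surjective.1, ⊥, inferInstance, inferInstance⟩

/-- **`Function.Surjective g.base` is what excludes junk**: with it dropped the crux is
TRIVIAL. Witness: a closed point `x` of `X` (one exists: `X` is quasi-compact, T₀ and non-empty),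
`X' = Spec κ(x)` (integral, zero-dimensional hence regular), `g` the closed immersion
`Spec κ(x) → X` (proper), `U = X ∖ {x}` (open; dense as soon as `X ≠ {x}`; over `U` the source is
EMPTY, so finiteness and radiciality hold vacuously); if `X = {x}` then `X` itself is a
zero-dimensional integral scheme, hence regular, and the identity does it. -/
theorem pialtWithoutSurjective_trivial :
    ∀ p : ℕ, p.Prime → ∀ (k : Type) [Field k] [CharP k p] (X : Scheme.{0})
      (f : X ⟶ Spec (.of k)), IsSeparated f → LocallyOfFiniteType f → QuasiCompact f →
        IsIntegral X → ∃ (X' : Scheme.{0}) (g : X' ⟶ X), IsProper g ∧ IsIntegral X' ∧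
          Scheme.IsRegular X' ∧ ∃ U : X.Opens, Dense (U : Set X) ∧ IsFinite (g ∣_ U) ∧
            UniversallyInjective (g ∣_ U) := by
  intro p hp k _ _ X f hs hl hq hi
  haveI : CompactSpace X := QuasiCompact.compactSpace_of_compactSpace f
  obtain ⟨x, -, hx⟩ :=
    (isClosed_univ : IsClosed (Set.univ : Set X)).exists_closed_singleton Set.univ_nonempty
  by_cases hX : ∃ y : X, y ≠ x
  · -- `X' = Spec κ(x)`, `U = X ∖ {x}`
    haveI : IsClosedImmersion (X.fromSpecResidueField x) :=
      isClosed_singleton_iff_isClosedImmersion.mp hx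
    let U : X.Opens := ⟨{x}ᶜ, hx.isOpen_compl⟩
    have hU : Dense (U : Set X) := by
      obtain ⟨y, hy⟩ := hX
      exact U.isOpen.dense ⟨y, Set.mem_compl_singleton_iff.mpr hy⟩
    haveI : IsEmpty (↑((X.fromSpecResidueField x) ⁻¹ᵁ U) : Scheme.{0}) := ⟨fun s => by
      have h1 : (X.fromSpecResidueField x).base s.1 ∈ (U : Set X) := s.2
      have h2 : (X.fromSpecResidueField x).base s.1 = x := X.fromSpecResidueField_apply x s.1
      rw [h2] at h1
      exact h1 rfl⟩
    exact ⟨_, X.fromSpecResidueField x, inferInstance, inferInstance,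
      Scheme.IsRegular.of_topologicalKrullDim_le_zero
        (topologicalKrullDim_zero_of_discreteTopology _), U, hU, inferInstance, inferInstance⟩
  · -- `X = {x}` is a zero-dimensional integral scheme, hence regular
    push Not at hX
    haveI : Subsingleton X := ⟨fun a b => (hX a).trans (hX b).symm⟩
    exact ⟨X, 𝟙 X, inferInstance, hi,
      Scheme.IsRegular.of_topologicalKrullDim_le_zero
        (topologicalKrullDim_zero_of_discreteTopology _), ⊤, by simp, inferInstance,
      inferInstance⟩

/-! ## §D Natural strengthenings -/

/-- The crux with "finite and universally injective over `U`" strengthened to "an isomorphism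
over `U`" (a regular MODIFICATION = weak resolution of the integral `X`). -/
def PialtBirational : Prop :=
  ∀ p : ℕ, p.Prime → ∀ (k : Type) [Field k] [CharP k p] (X : Scheme.{0})
    (f : X ⟶ Spec (.of k)), IsSeparated f → LocallyOfFiniteType f → QuasiCompact f →
      IsIntegral X → ∃ (X' : Scheme.{0}) (g : X' ⟶ X), IsProper g ∧ IsIntegral X' ∧
        Scheme.IsRegular X' ∧ Function.Surjective g.base ∧
          ∃ U : X.Opens, Dense (U : Set X) ∧ IsIso (g ∣_ U)

/-- **The birational strengthening of the crux is exactly the summit** (using the in-tree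
reduced → integral descent `DescentReducedToIntegral_holds`). So the distance from `Pialt` to the
summit is precisely "universally injective ↦ isomorphism over the dense open". -/
theorem pialtBirational_iff_resolutionOfSingularities :
    PialtBirational ↔ _root_.ResolutionOfSingularities := by
  constructor
  · intro h p hp k _ _ X f hs hl hq hr
    refine Theses.PAlteration.DescentReducedToIntegral_holds k ?_ X f hs hl hq hr
    intro Y g hs' hl' hq' hi'
    obtain ⟨X', π, hprop, hint, hreg, hsurj, U, hU, hiso⟩ := h p hp k Y g hs' hl' hq' hi'
    refine ⟨X', π, hprop, ⟨U, hU, ?_, hiso⟩, hreg⟩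
    -- `π⁻¹ U` is a non-empty open of the irreducible `X'`, hence dense
    obtain ⟨y, hy⟩ := hU.nonempty
    obtain ⟨x, hx⟩ := hsurj y
    refine (π ⁻¹ᵁ U).isOpen.dense ⟨x, ?_⟩
    show π.base x ∈ (U : Set Y)
    rw [hx]; exact hy
  · intro h p hp k _ _ X f hs hl hq hi
    obtain ⟨X', π, hπ⟩ := h p hp k X f hs hl hq inferInstance
    haveI : IsReduced X' := hπ.isRegular.isReduced
    haveI : IsIntegral X' := hπ.isBirational.isIntegral
    obtain ⟨U, hU, -, hiso⟩ := hπ.isBirational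
    exact ⟨X', π, hπ.isProper, inferInstance, hπ.isRegular,
      (hπ.isPurelyInseparableAlteration.surjective).1, U, hU, hiso⟩

/-- So a disproof of the crux disproves its birational strengthening (= the summit). -/
theorem not_pialtBirational_of_not_pialt (h : ¬ Pialt) : ¬ PialtBirational := fun hB =>
  not_resolutionOfSingularities_of_not_pialt h (pialtBirational_iff_resolutionOfSingularities.mp hB)

/-! ## §D' The finite strengthening (no blow-up) is false: the node -/

/-! ### Helpers: sections pulled back along a surjective morphism to an affine scheme -/

/-- If `g : X' → Spec R` is surjective and the pull-back of `r ∈ R` vanishes on `X'`, then `r` is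
nilpotent (`D(r)` has empty preimage, hence is empty). [folklore] -/
theorem isNilpotent_of_appTop_eq_zero {R : Type} [CommRing R] {X' : Scheme.{0}}
    (g : X' ⟶ Spec (.of R)) (hsurj : Function.Surjective g.base) (r : R)
    (h : g.appTop ((Scheme.ΓSpecIso (.of R)).inv r) = 0) : IsNilpotent r := by
  have hpre : g ⁻¹ᵁ (Spec (.of R)).basicOpen ((Scheme.ΓSpecIso (.of R)).inv r) = ⊥ := by
    rw [Scheme.preimage_basicOpen_top, h, Scheme.basicOpen_zero]
  have hD' : (Spec (.of R)).basicOpen ((Scheme.ΓSpecIso (.of R)).inv r) = ⊥ := by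
    ext z
    simp only [TopologicalSpace.Opens.coe_bot, Set.mem_empty_iff_false, iff_false]
    intro hz
    obtain ⟨w, hw⟩ := hsurj z
    have hw' : w ∈ g ⁻¹ᵁ (Spec (.of R)).basicOpen ((Scheme.ΓSpecIso (.of R)).inv r) := by
      show g.base w ∈ ((Spec (.of R)).basicOpen _ : Set _)
      rw [hw]; exact hz
    rw [hpre] at hw'
    exact hw'
  rw [basicOpen_eq_of_affine] at hD'
  exact (PrimeSpectrum.basicOpen_eq_bot_iff _).mp hD'

/-- If `g : X' → Spec R` is surjective and the pull-back of `r ∈ R` is a unit on `X'`, then `r`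
is a unit (`D(r)` has full preimage, hence is everything). [folklore] -/
theorem isUnit_of_isUnit_appTop {R : Type} [CommRing R] {X' : Scheme.{0}}
    (g : X' ⟶ Spec (.of R)) (hsurj : Function.Surjective g.base) (r : R)
    (h : IsUnit (g.appTop ((Scheme.ΓSpecIso (.of R)).inv r))) : IsUnit r := by
  by_contra hr
  obtain ⟨M, hM, hrM⟩ := exists_max_ideal_of_mem_nonunits hr
  let y : ↥(Spec (.of R)) := (⟨M, hM.isPrime⟩ : PrimeSpectrum R)
  obtain ⟨x, hx⟩ := hsurj y
  have hxmem : x ∈ X'.basicOpen (g.appTop ((Scheme.ΓSpecIso (.of R)).inv r)) :=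
    (Scheme.mem_basicOpen_top _ _ _).mpr (h.map _)
  rw [← Scheme.preimage_basicOpen_top] at hxmem
  have h2 : g.base x ∈ (Spec (.of R)).basicOpen ((Scheme.ΓSpecIso (.of R)).inv r) := hxmem
  rw [hx, basicOpen_eq_of_affine] at h2
  exact (PrimeSpectrum.mem_basicOpen _ _).mp h2 hrM

/-! ### The node `k[T² − T, T³ − T²]` -/

/-- Elements of the node algebra `k[T² − T, T³ − T²] ⊆ k[T]` take the same value at `0` and at
`1` (the node is the affine line with `0` and `1` glued). [folklore] -/
theorem node_eval_zero_eq_eval_one {k : Type} [Field k] (a : k[X])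
    (ha : a ∈ Algebra.adjoin k ({X ^ 2 - X, X ^ 3 - X ^ 2} : Set k[X])) :
    a.eval 0 = a.eval 1 := by
  induction ha using Algebra.adjoin_induction with
  | mem x hx =>
    simp only [Set.mem_insert_iff, Set.mem_singleton_iff] at hx
    rcases hx with rfl | rfl <;> simp
  | algebraMap r => simp
  | add x y _ _ hx hy => simp [hx, hy]
  | mul x y _ _ hx hy => simp [hx, hy]

/-- **The finite strengthening of the crux is false**, at every prime `p`: it is NOT true that
every integral separated finite-type `X / k` (`char k = p`) admits a FINITE, universally injective,
surjective morphism from an integral regular scheme (i.e. that the purely inseparable regular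
alteration can be taken finite over all of `X`, with no blow-up). Witness: the node
`X = Spec k[T² − T, T³ − T²]` (`k = 𝔽_p`; the affine line with `0 ∼ 1`). If `g : X' → X` is
finite, radicial and surjective with `X'` integral and regular, then `X' = Spec B` is affine, `B`
is a normal domain finite over `A = k[T² − T, T³ − T²]` (regular local rings are integrally
closed, Matsumura 19.4, and normality is local), so `T = (T³ − T²)/(T² − T)` — integral over `A` —
lies in `B`: there is `τ ∈ B` with `τ² − τ = u`, `τ u = v` (`u, v` the two generators). The
substitution `T ↦ τ` gives `χ : k[T] → B` extending `A → B`; `B` is finite over `k[T]`, and `χ` is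
injective (else `k[T]/ker χ` is a field inside `B` in which `u = τ² − τ ≠ 0` becomes a unit, while
`u` is not a unit on `X`, and pull-back along the surjective `g` reflects units). Lying over gives
primes `Q₀ ∋ τ` over `(T)` and `Q₁ ∋ τ − 1` over `(T − 1)` of `B`, distinct, but with the same
contraction to `A` (an element of `A` vanishes at `0` iff it vanishes at `1`): two points of `X'`
over the node, contradicting injectivity. So at non-(geometrically-)unibranch points the
alteration of the crux must genuinely blow up. [folklore] -/
theorem not_pialtFinite_at (p : ℕ) [Fact p.Prime] :
    ¬ ∀ (k : Type) [Field k] [CharP k p] (X : Scheme.{0}) (f : X ⟶ Spec (.of k)),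
      IsSeparated f → LocallyOfFiniteType f → QuasiCompact f → IsIntegral X →
        ∃ (X' : Scheme.{0}) (g : X' ⟶ X), IsIntegral X' ∧ Scheme.IsRegular X' ∧
          IsFinite g ∧ UniversallyInjective g ∧ Function.Surjective g.base := by
  intro h
  -- the node over `𝔽_p`
  let A : Subalgebra (ZMod p) (ZMod p)[X] :=
    Algebra.adjoin (ZMod p) ({X ^ 2 - X, X ^ 3 - X ^ 2} : Set (ZMod p)[X])
  haveI : Algebra.FiniteType (ZMod p) ↥A := by
    refine ⟨(Subalgebra.fg_top A).mpr ⟨{X ^ 2 - X, X ^ 3 - X ^ 2}, ?_⟩⟩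
    simp [A]
  let f : Spec (.of ↥A) ⟶ Spec (.of (ZMod p)) :=
    Spec.map (CommRingCat.ofHom (algebraMap (ZMod p) ↥A))
  haveI : LocallyOfFiniteType f :=
    (HasRingHomProperty.Spec_iff (P := @LocallyOfFiniteType)).mpr
      (RingHom.finiteType_algebraMap.mpr inferInstance)
  obtain ⟨X', g, hint, hreg, hfin, hui, hsurj⟩ :=
    h (ZMod p) (Spec (.of ↥A)) f inferInstance inferInstance inferInstance inferInstance
  -- `X'` is affine and `B = Γ(X', ⊤)` is finite over `A`
  haveI : IsAffine X' := isAffine_of_isAffineHom g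
  obtain ⟨-, hfinT⟩ := (HasAffineProperty.iff_of_isAffine (P := @IsFinite)).mp hfin
  let ι : CommRingCat.of ↥A ⟶ Γ(Spec (.of ↥A), ⊤) := (Scheme.ΓSpecIso (.of ↥A)).inv
  let ψ : ↥A →+* ↑Γ(X', ⊤) := g.appTop.hom.comp ι.hom
  have hψfin : ψ.Finite :=
    hfinT.comp (RingHom.Finite.of_surjective ι.hom
      (Scheme.ΓSpecIso (.of ↥A)).commRingCatIsoToRingEquiv.symm.surjective)
  -- the generators `u = T² - T`, `v = T³ - T² = T u`, with `v² = u³ + u v`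
  have hu_mem : (X ^ 2 - X : (ZMod p)[X]) ∈ A := Algebra.subset_adjoin (by simp)
  have hv_mem : (X ^ 3 - X ^ 2 : (ZMod p)[X]) ∈ A := Algebra.subset_adjoin (by simp)
  let u : ↥A := ⟨X ^ 2 - X, hu_mem⟩
  let v : ↥A := ⟨X ^ 3 - X ^ 2, hv_mem⟩
  have huv : v ^ 2 = u ^ 3 + u * v := by
    apply Subtype.ext
    simp only [u, v, SubmonoidClass.mk_pow, Subalgebra.coe_add, Subalgebra.coe_mul]
    ring
  have hu_natDegree : (X ^ 2 - X : (ZMod p)[X]).natDegree = 2 := by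
    rw [Polynomial.natDegree_sub_eq_left_of_natDegree_lt] <;> simp
  have hu0 : u ≠ 0 := by
    intro h0
    have h1 : (X ^ 2 - X : (ZMod p)[X]) = 0 := congrArg Subtype.val h0
    have h2 := congrArg Polynomial.natDegree h1
    rw [hu_natDegree, Polynomial.natDegree_zero] at h2
    exact absurd h2 (by norm_num)
  -- `ψ u ≠ 0` and `ψ u` is not a unit (pull-back along the surjective `g` reflects both)
  have hψu0 : ψ u ≠ 0 := fun h0 =>
    hu0 (isNilpotent_of_appTop_eq_zero g hsurj u h0).eq_zero
  have hψu_nu : ¬ IsUnit (ψ u) := fun hunit => by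
    have h1 : IsUnit u := isUnit_of_isUnit_appTop g hsurj u hunit
    have h2 : IsUnit (u : (ZMod p)[X]) := h1.map A.val
    have h3 := Polynomial.natDegree_eq_zero_of_isUnit h2
    have h4 : (u : (ZMod p)[X]).natDegree = 2 := hu_natDegree
    omega
  -- `B` is an integrally closed domain (regular local rings are normal; normality is local)
  have hIC : IsIntegrallyClosed ↑Γ(X', ⊤) := by
    refine IsIntegrallyClosed.of_localization_maximal fun P _ hP => ?_
    let q : ↥(Spec Γ(X', ⊤)) := (⟨P, hP.isPrime⟩ : PrimeSpectrum ↑Γ(X', ⊤))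
    have h1 : IsRegularLocalRing ↑(X'.presheaf.stalk (X'.isoSpec.inv.base q)) := hreg _
    haveI h2 : IsRegularLocalRing ↑((Spec Γ(X', ⊤)).presheaf.stalk q) :=
      IsRegularLocalRing.of_ringEquiv (asIso (X'.isoSpec.inv.stalkMap q)).commRingCatIsoToRingEquiv
    haveI : IsRegularLocalRing (Localization.AtPrime P) :=
      IsRegularLocalRing.of_ringEquiv (Spec.stalkIso Γ(X', ⊤) q).commRingCatIsoToRingEquiv
    exact isIntegrallyClosed_of_isRegularLocalRing _
  -- `τ ∈ B` with `τ ψ(u) = ψ(v)` and `τ² - τ = ψ(u)`: the image of `T`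
  obtain ⟨τ, hτu, hτ2⟩ : ∃ τ : ↑Γ(X', ⊤), τ * ψ u = ψ v ∧ τ ^ 2 - τ = ψ u := by
    let K := FractionRing ↑Γ(X', ⊤)
    have hKu : algebraMap ↑Γ(X', ⊤) K (ψ u) ≠ 0 := fun h0 =>
      hψu0 (IsFractionRing.injective ↑Γ(X', ⊤) K (h0.trans (map_zero _).symm))
    set θ : K := algebraMap _ K (ψ v) / algebraMap _ K (ψ u) with hθdef
    have hrel : (ψ v) ^ 2 = (ψ u) ^ 3 + ψ u * ψ v := by
      rw [← map_pow, huv, map_add, map_pow, map_mul]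
    have hrelK : (algebraMap _ K (ψ v)) ^ 2 =
        (algebraMap _ K (ψ u)) ^ 3 + algebraMap _ K (ψ u) * algebraMap _ K (ψ v) := by
      have := congrArg (algebraMap ↑Γ(X', ⊤) K) hrel
      simpa only [map_pow, map_add, map_mul] using this
    have hθb : θ * algebraMap _ K (ψ u) = algebraMap _ K (ψ v) := div_mul_cancel₀ _ hKu
    have hθ : θ ^ 2 - θ - algebraMap _ K (ψ u) = 0 := by
      have key : (θ ^ 2 - θ - algebraMap _ K (ψ u)) * (algebraMap _ K (ψ u)) ^ 2 = 0 := by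
        linear_combination
          (θ * algebraMap _ K (ψ u) + algebraMap _ K (ψ v) - algebraMap _ K (ψ u)) * hθb + hrelK
      rcases mul_eq_zero.mp key with h1 | h1
      · exact h1
      · exact absurd ((pow_eq_zero_iff two_ne_zero).mp h1) hKu
    have hmonic : (X ^ 2 - X - C (ψ u) : (↑Γ(X', ⊤))[X]).Monic := by
      rw [sub_sub]
      apply (Polynomial.monic_X_pow 2).sub_of_left
      refine (Polynomial.degree_add_le _ _).trans_lt ?_
      rw [Polynomial.degree_X_pow, Polynomial.degree_X, Polynomial.degree_C hψu0]
      decide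
    have hθint : IsIntegral ↑Γ(X', ⊤) θ := by
      refine ⟨X ^ 2 - X - C (ψ u), hmonic, ?_⟩
      simp only [Polynomial.eval₂_sub, Polynomial.eval₂_X_pow, Polynomial.eval₂_X,
        Polynomial.eval₂_C]
      exact hθ
    obtain ⟨τ, hτ⟩ := (isIntegrallyClosed_iff K).mp hIC hθint
    refine ⟨τ, ?_, ?_⟩
    · apply IsFractionRing.injective ↑Γ(X', ⊤) K
      rw [map_mul, hτ, hθb]
    · apply IsFractionRing.injective ↑Γ(X', ⊤) K
      rw [map_sub, map_pow, hτ]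
      linear_combination hθ
  -- `χ : k[T] → B`, `T ↦ τ`, extends `ψ`
  let χ : (ZMod p)[X] →+* ↑Γ(X', ⊤) :=
    Polynomial.eval₂RingHom (ψ.comp (algebraMap (ZMod p) ↥A)) τ
  have hχX : χ X = τ := Polynomial.eval₂_X _ _
  have hχC : ∀ r, χ (C r) = ψ (algebraMap (ZMod p) ↥A r) := fun r => Polynomial.eval₂_C _ _
  have hχu : χ (X ^ 2 - X) = ψ u := by
    rw [map_sub, map_pow, hχX, hτ2]
  have hχv : χ (X ^ 3 - X ^ 2) = ψ v := by
    have : χ (X ^ 3 - X ^ 2) = τ * (τ ^ 2 - τ) := by rw [map_sub, map_pow, map_pow, hχX]; ring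
    rw [this, hτ2, hτu]
  have hagree : ∀ (a : (ZMod p)[X]) (ha : a ∈ A), χ a = ψ ⟨a, ha⟩ := by
    intro a ha
    induction ha using Algebra.adjoin_induction with
    | mem x hx =>
      simp only [Set.mem_insert_iff, Set.mem_singleton_iff] at hx
      rcases hx with rfl | rfl
      · exact hχu
      · exact hχv
    | algebraMap r => exact hχC r
    | add x y hx hy ihx ihy =>
      rw [map_add, ihx, ihy, ← map_add]; rfl
    | mul x y hx hy ihx ihy =>
      rw [map_mul, ihx, ihy, ← map_mul]; rfl
  have hagree' : ∀ a : ↥A, χ (a : (ZMod p)[X]) = ψ a := fun a => hagree a.1 a.2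
  -- `B` is integral over `k[T]` via `χ` (it is finite, hence integral, over `A` via `ψ`)
  letI algχ : Algebra (ZMod p)[X] ↑Γ(X', ⊤) := χ.toAlgebra
  have hψint : ψ.IsIntegral := hψfin.to_isIntegral
  have hcompval : (algebraMap (ZMod p)[X] ↑Γ(X', ⊤)).comp (algebraMap ↥A (ZMod p)[X]) = ψ :=
    RingHom.ext fun a => hagree' a
  haveI : Algebra.IsIntegral (ZMod p)[X] ↑Γ(X', ⊤) := ⟨fun b => by
    obtain ⟨P, hPm, hPb⟩ := hψint b
    refine ⟨P.map (algebraMap ↥A (ZMod p)[X]), hPm.map _, ?_⟩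
    rw [Polynomial.eval₂_map, hcompval]
    exact hPb⟩
  -- `χ` is injective
  have hχinj : RingHom.ker χ = ⊥ := by
    by_contra hne
    haveI hprime : (RingHom.ker χ).IsPrime := RingHom.ker_isPrime χ
    haveI hmax : (RingHom.ker χ).IsMaximal := IsPrime.to_maximal_ideal hne
    have hcls : Ideal.Quotient.mk (RingHom.ker χ) (X ^ 2 - X) ≠ 0 := by
      rw [Ne, Ideal.Quotient.eq_zero_iff_mem, RingHom.mem_ker, hχu]
      exact hψu0
    letI := Ideal.Quotient.field (RingHom.ker χ)
    have hunit : IsUnit (Ideal.Quotient.mk (RingHom.ker χ) (X ^ 2 - X)) :=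
      isUnit_iff_ne_zero.mpr hcls
    have h1 := hunit.map (Ideal.Quotient.lift (RingHom.ker χ) χ fun a ha => ha)
    rw [Ideal.Quotient.lift_mk, hχu] at h1
    exact hψu_nu h1
  -- two primes of `B`, over `(T)` and over `(T - 1)`
  have hcomap_bot : Ideal.comap (algebraMap (ZMod p)[X] ↑Γ(X', ⊤)) ⊥ = ⊥ := by
    show Ideal.comap χ ⊥ = ⊥
    rw [← RingHom.ker_eq_comap_bot, hχinj]
  let 𝔭₀ : Ideal (ZMod p)[X] := Ideal.span {X}
  let 𝔭₁ : Ideal (ZMod p)[X] := Ideal.span {X - C 1}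
  haveI : 𝔭₀.IsPrime :=
    (Ideal.span_singleton_prime Polynomial.X_ne_zero).mpr Polynomial.prime_X
  haveI : 𝔭₁.IsPrime :=
    (Ideal.span_singleton_prime (Polynomial.X_sub_C_ne_zero 1)).mpr (Polynomial.prime_X_sub_C 1)
  obtain ⟨Q₀, -, hQ₀, hQ₀c⟩ := Ideal.exists_ideal_over_prime_of_isIntegral 𝔭₀
    (⊥ : Ideal ↑Γ(X', ⊤)) (by rw [hcomap_bot]; exact bot_le)
  obtain ⟨Q₁, -, hQ₁, hQ₁c⟩ := Ideal.exists_ideal_over_prime_of_isIntegral 𝔭₁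
    (⊥ : Ideal ↑Γ(X', ⊤)) (by rw [hcomap_bot]; exact bot_le)
  have hQne : Q₀ ≠ Q₁ := by
    intro heq
    have h1 : 𝔭₀ = 𝔭₁ := by rw [← hQ₀c, ← hQ₁c, heq]
    have hX1 : (X : (ZMod p)[X]) ∈ 𝔭₁ := h1 ▸ Ideal.mem_span_singleton_self X
    rw [Ideal.mem_span_singleton, Polynomial.dvd_iff_isRoot] at hX1
    simp at hX1
  -- ... with the same contraction to `A`
  have hsame : Q₀.comap ψ = Q₁.comap ψ := by
    ext a
    rw [Ideal.mem_comap, Ideal.mem_comap, ← hagree' a]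
    have e0 : χ (a : (ZMod p)[X]) ∈ Q₀ ↔ (a : (ZMod p)[X]) ∈ 𝔭₀ := by
      rw [← hQ₀c, Ideal.mem_comap]; rfl
    have e1 : χ (a : (ZMod p)[X]) ∈ Q₁ ↔ (a : (ZMod p)[X]) ∈ 𝔭₁ := by
      rw [← hQ₁c, Ideal.mem_comap]; rfl
    rw [e0, e1, Ideal.mem_span_singleton, Ideal.mem_span_singleton, Polynomial.X_dvd_iff,
      Polynomial.dvd_iff_isRoot, Polynomial.IsRoot.def, Polynomial.coeff_zero_eq_eval_zero,
      node_eval_zero_eq_eval_one _ a.2]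
  -- the corresponding two points of `X'` have the same image under `g`: contradiction
  haveI := hui
  let q₀ : ↥(Spec Γ(X', ⊤)) := (⟨Q₀, hQ₀⟩ : PrimeSpectrum _)
  let q₁ : ↥(Spec Γ(X', ⊤)) := (⟨Q₁, hQ₁⟩ : PrimeSpectrum _)
  have hnat : X'.isoSpec.inv ≫ g = Spec.map (ι ≫ g.appTop) := by
    rw [← Scheme.isoSpec_inv_naturality g, Scheme.isoSpec_Spec_inv, ← Spec.map_comp]
  have hg : ∀ q : ↥(Spec Γ(X', ⊤)),
      g.base (X'.isoSpec.inv.base q) = PrimeSpectrum.comap ψ q := by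
    intro q
    have h1 := congrArg (fun φ : Spec Γ(X', ⊤) ⟶ Spec (.of ↥A) => φ.base q) hnat
    exact h1
  have heq : q₀ = q₁ := by
    apply (Scheme.homeoOfIso X'.isoSpec.symm).injective
    apply g.injective
    show g.base (X'.isoSpec.inv.base q₀) = g.base (X'.isoSpec.inv.base q₁)
    rw [hg, hg]
    exact PrimeSpectrum.ext hsame
  exact hQne (congrArg (fun q : PrimeSpectrum ↑Γ(X', ⊤) => q.asIdeal) heq)


/-- **The finite strengthening of the crux is false** (all primes quantified, the crux's own
shape with "finite + universally injective over a dense open `U`" replaced by "finite +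
universally injective over all of `X`"). [folklore] -/
theorem not_pialtFinite :
    ¬ ∀ p : ℕ, p.Prime → ∀ (k : Type) [Field k] [CharP k p] (X : Scheme.{0})
      (f : X ⟶ Spec (.of k)), IsSeparated f → LocallyOfFiniteType f → QuasiCompact f →
        IsIntegral X → ∃ (X' : Scheme.{0}) (g : X' ⟶ X), IsIntegral X' ∧ Scheme.IsRegular X' ∧
          IsFinite g ∧ UniversallyInjective g ∧ Function.Surjective g.base :=
  fun h => not_pialtFinite_at 2 (fun k _ _ X f hs hl hq hi => h 2 Nat.prime_two k X f hs hl hq hi)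

end Summit.ResolutionOfSingularities.ResolutionOfSingularities.Cruxes.Pialt.Disproof

end
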